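import Summits.QuantumAdvantage.QuantumAdvantage.Theorems.CubicForrelationNearExactIsExactTwelveZ512SignAffine

/-!
# Crux `CubicForrelation.NearExactIsExact` (stmt-QuantumAdvantage-14043) — infrastructure: a FRAME (linear basis) for an xor-closed set, and the
  parametrisation of its cosets by a coordinate cube

Certificate seat `b2b-cforr-cert` (gen 27).  HONEST FRAMING: bookkeeping lemmas (standard axioms) about xor-closed subsets of `𝔽₂ⁿ`; the first
half of a COSET → CUBE TRANSFER that lets the tree's absolute Reed–Muller / Kasami–Tokura bricks (stated for `Fin m → Bool` with `IsDegLeFun`) be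
used on abstract flats `c ⊕ V` (where the tree only has the "even parametrised flat sums" language).  Needed by the remaining level-5 branches of
the `n = 12` window (PLAN-N12-WINDOW-O5.md); NOT summit progress.

* `ffr_flatPt_add`: the flat point of the origin `⊕_{θᵢ} bᵢ` is additive in the parameter `θ`.
* `ffr_frame_step` / `ffr_frame_exists`: an xor-closed `V ∋ 0` with `#V = 2^m` has, for every `k ≤ m`, `k` vectors `b₀,…,b_{k−1} ∈ V` whose
  parametrisation `θ ↦ ⊕_{θᵢ} bᵢ` is injective (greedy: a vector of `V` outside the current image doubles it).
* `ffr_frame`: for `k = m` the parametrisation is a bijection `𝔽₂^m → V` (additive by `ffr_flatPt_add`).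
* `ffr_flat_transport`: a parametrised flat of the coset `c ⊕ V` with base `c ⊕ φ(θ₀)` and directions `φ(αₗ)` is the `φ`-image of the
  parametrised flat `θ₀ ⊕ ⟨αₗ⟩` of the cube.

References: MacWilliams–Sloane (1977) Ch. 13 §2 (cosets of linear codes); folklore linear algebra over `𝔽₂`.  Axioms: the standard three.
-/

set_option linter.dupNamespace false -- D-0017: single-problem summit ⇒ `QuantumAdvantage.QuantumAdvantage` by design

noncomputable section

namespace Summit.QuantumAdvantage.QuantumAdvantage.Theorems.CubicForrelation.NearExactIsExact

open Finset
open Literature.Computability.QuantumComplexity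
open Literature.Computability.QuantumComplexity.BuzetChailloux (bxor zeroVec bxor_bxor_cancel_left bxor_zeroVec zeroVec_bxor bxor_comm
  bxor_self)

variable {n : ℕ}

/-! ### Additivity of the parametrisation -/

/-- **The flat point of the origin is additive in the parameter**: `⊕_{(θ⊕θ')ᵢ} bᵢ = (⊕_{θᵢ} bᵢ) ⊕ (⊕_{θ'ᵢ} bᵢ)`. [folklore] -/
theorem ffr_flatPt_add {k : ℕ} (b : Fin k → Fin n → Bool) (θ θ' : Fin k → Bool) :
    (fun j => zeroVec j ^^ decide (Odd #(univ.filter fun i => (bxor θ θ') i && b i j))) =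
      bxor (fun j => zeroVec j ^^ decide (Odd #(univ.filter fun i => θ i && b i j)))
        (fun j => zeroVec j ^^ decide (Odd #(univ.filter fun i => θ' i && b i j))) := by
  funext j
  have hip := ffl_ip_bxor θ θ' (fun i => b i j)
  simp only [bxor] at hip ⊢
  rw [hip]
  simp only [zeroVec, Bool.false_xor]

/-- The parametrisation sends `0` to `0`. [folklore] -/
theorem ffr_flatPt_zero {k : ℕ} (b : Fin k → Fin n → Bool) :
    (fun j => zeroVec j ^^ decide (Odd #(univ.filter fun i => (zeroVec : Fin k → Bool) i && b i j))) = zeroVec := by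
  funext j
  have : (univ.filter fun i => (zeroVec : Fin k → Bool) i && b i j) = ∅ := filter_eq_empty_iff.2 fun i _ => by simp [zeroVec]
  rw [this]; simp [zeroVec]

/-! ### Frames -/

/-- **Frame extension**: if `b : Fin k → V` parametrises injectively and `v ∈ V` is outside the image, then `cons v b` parametrises injectively.
[folklore] -/
theorem ffr_frame_step {k : ℕ} (b : Fin k → Fin n → Bool)
    (hinj : Function.Injective (fun θ : Fin k → Bool => (fun j => zeroVec j ^^ decide (Odd #(univ.filter fun i => θ i && b i j)))))
    (v : Fin n → Bool) (hv : ∀ θ : Fin k → Bool, (fun j => zeroVec j ^^ decide (Odd #(univ.filter fun i => θ i && b i j))) ≠ v) :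
    Function.Injective (fun ε : Fin (k + 1) → Bool =>
      (fun j => zeroVec j ^^ decide (Odd #(univ.filter fun i => ε i && (Fin.cons v b : Fin (k + 1) → Fin n → Bool) i j)))) := by
  intro ε ε' h
  have eε : ε = Fin.cons (ε 0) (Fin.tail ε) := (Fin.cons_self_tail ε).symm
  have eε' : ε' = Fin.cons (ε' 0) (Fin.tail ε') := (Fin.cons_self_tail ε').symm
  dsimp only at h
  rw [eε, eε', erm_flatPt_cons, erm_flatPt_cons] at h
  -- compare the first parameters
  by_cases h0 : ε 0 = ε' 0
  · have ht : Fin.tail ε = Fin.tail ε' := by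
      apply hinj
      funext j
      show (zeroVec j ^^ decide (Odd #(univ.filter fun i => Fin.tail ε i && b i j))) =
        (zeroVec j ^^ decide (Odd #(univ.filter fun i => Fin.tail ε' i && b i j)))
      have hj : ((zeroVec j ^^ decide (Odd #(univ.filter fun i => Fin.tail ε i && b i j))) ^^ (ε 0 && v j)) =
          ((zeroVec j ^^ decide (Odd #(univ.filter fun i => Fin.tail ε' i && b i j))) ^^ (ε' 0 && v j)) := congrFun h j
      rw [h0] at hj
      revert hj
      cases (zeroVec j ^^ decide (Odd #(univ.filter fun i => Fin.tail ε i && b i j))) <;>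
        cases (zeroVec j ^^ decide (Odd #(univ.filter fun i => Fin.tail ε' i && b i j))) <;> cases (ε' 0 && v j) <;> decide
    rw [eε, eε', h0, ht]
  · exfalso
    apply hv (bxor (Fin.tail ε) (Fin.tail ε'))
    rw [ffr_flatPt_add]
    funext j
    have hj : ((zeroVec j ^^ decide (Odd #(univ.filter fun i => Fin.tail ε i && b i j))) ^^ (ε 0 && v j)) =
        ((zeroVec j ^^ decide (Odd #(univ.filter fun i => Fin.tail ε' i && b i j))) ^^ (ε' 0 && v j)) := congrFun h j
    simp only [bxor]
    revert hj h0
    cases (zeroVec j ^^ decide (Odd #(univ.filter fun i => Fin.tail ε i && b i j))) <;>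
      cases (zeroVec j ^^ decide (Odd #(univ.filter fun i => Fin.tail ε' i && b i j))) <;> cases ε 0 <;> cases ε' 0 <;> cases v j <;> decide

/-- **Frames exist**: an xor-closed `V ∋ 0` with `#V = 2^m` contains, for every `k ≤ m`, `k` vectors parametrising injectively. [folklore] -/
theorem ffr_frame_exists (V : Finset (Fin n → Bool)) (h0 : zeroVec ∈ V) (hadd : ∀ a ∈ V, ∀ b ∈ V, bxor a b ∈ V) {m : ℕ} (hcard : #V = 2 ^ m) :
    ∀ k ≤ m, ∃ b : Fin k → Fin n → Bool, (∀ i, b i ∈ V) ∧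
      Function.Injective (fun θ : Fin k → Bool => (fun j => zeroVec j ^^ decide (Odd #(univ.filter fun i => θ i && b i j)))) := by
  classical
  intro k
  induction k with
  | zero =>
    intro _
    refine ⟨fun i => i.elim0, fun i => i.elim0, fun θ θ' _ => funext fun i => i.elim0⟩
  | succ k ih =>
    intro hk
    obtain ⟨b, hbV, hinj⟩ := ih (by omega)
    -- the image of the `k`-frame has `2^k < 2^m = #V` elements: pick `v ∈ V` outside it
    set Im := (univ : Finset (Fin k → Bool)).image (fun θ : Fin k → Bool => (fun j => zeroVec j ^^ decide (Odd #(univ.filter fun i => θ i && b i j)))) with hIm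
    have hImcard : #Im = 2 ^ k := by
      rw [hIm, card_image_of_injective _ hinj, card_univ, Fintype.card_fun, Fintype.card_bool, Fintype.card_fin]
    have hlt : #Im < #V := by
      rw [hImcard, hcard]; exact Nat.pow_lt_pow_right (by norm_num) (by omega)
    have hImV : Im ⊆ V := by
      intro w hw
      obtain ⟨θ, -, rfl⟩ := mem_image.1 hw
      exact ws_flatPt_mem V h0 (· ∈ V) (fun z hz a ha => hadd z hz a ha) k zeroVec h0 b hbV θ
    obtain ⟨v, hvV, hvIm⟩ := exists_mem_notMem_of_card_lt_card hlt
    refine ⟨Fin.cons v b, fun i => Fin.cases hvV hbV i, ffr_frame_step b hinj v fun θ hθ => hvIm ?_⟩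
    exact mem_image.2 ⟨θ, mem_univ _, hθ⟩

/-- **A full frame is a bijection onto `V`**: for `k = m` every `v ∈ V` is parametrised. [folklore] -/
theorem ffr_frame (V : Finset (Fin n → Bool)) (h0 : zeroVec ∈ V) (hadd : ∀ a ∈ V, ∀ b ∈ V, bxor a b ∈ V) {m : ℕ} (hcard : #V = 2 ^ m) :
    ∃ b : Fin m → Fin n → Bool, (∀ i, b i ∈ V) ∧
      Function.Injective (fun θ : Fin m → Bool => (fun j => zeroVec j ^^ decide (Odd #(univ.filter fun i => θ i && b i j)))) ∧
      ∀ v ∈ V, ∃ θ : Fin m → Bool, (fun j => zeroVec j ^^ decide (Odd #(univ.filter fun i => θ i && b i j))) = v := by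
  classical
  obtain ⟨b, hbV, hinj⟩ := ffr_frame_exists V h0 hadd hcard m le_rfl
  refine ⟨b, hbV, hinj, fun v hv => ?_⟩
  set Im := (univ : Finset (Fin m → Bool)).image (fun θ : Fin m → Bool => (fun j => zeroVec j ^^ decide (Odd #(univ.filter fun i => θ i && b i j)))) with hIm
  have hImV : Im ⊆ V := by
    intro w hw
    obtain ⟨θ, -, rfl⟩ := mem_image.1 hw
    exact ws_flatPt_mem V h0 (· ∈ V) (fun z hz a ha => hadd z hz a ha) m zeroVec h0 b hbV θ
  have hImcard : #Im = #V := by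
    rw [hIm, card_image_of_injective _ hinj, card_univ, Fintype.card_fun, Fintype.card_bool, Fintype.card_fin, hcard]
  have hEq : Im = V := eq_of_subset_of_card_le hImV (by rw [hImcard])
  have hv' : v ∈ Im := by rw [hEq]; exact hv
  obtain ⟨θ, -, hθ⟩ := mem_image.1 hv'
  exact ⟨θ, hθ⟩

/-! ### Transport of parametrised flats -/

/-- Peeling the first direction of a parametrised flat point (tail form of `erm_flatPt_cons`). [folklore] -/
theorem ffr_flatPt_peel {N k : ℕ} (x : Fin N → Bool) (a : Fin (k + 1) → Fin N → Bool) (ε : Fin (k + 1) → Bool) :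
    (fun j => x j ^^ decide (Odd #(univ.filter fun i => ε i && a i j))) =
      fun j => (x j ^^ decide (Odd #(univ.filter fun i : Fin k => Fin.tail ε i && Fin.tail a i j))) ^^ (ε 0 && a 0 j) := by
  have h := erm_flatPt_cons x (a 0) (Fin.tail a) (ε 0) (Fin.tail ε)
  rw [Fin.cons_self_tail, Fin.cons_self_tail] at h
  exact h

/-- **Nested parametrisation**: the flat point with base `⊕_{θ₀} b` and directions `aₗ = ⊕_{αₗ} b` (parameters `ε`) is the `b`-parametrisation of
the cube flat point `θ₀ ⊕ ⊕_{εₗ} αₗ`. [folklore] -/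
theorem ffr_flat_transport {m k : ℕ} (b : Fin m → Fin n → Bool) (θ₀ : Fin m → Bool) (α : Fin k → Fin m → Bool) (ε : Fin k → Bool) :
    (fun j => (fun j => zeroVec j ^^ decide (Odd #(univ.filter fun i => θ₀ i && b i j))) j ^^
        decide (Odd #(univ.filter fun l => ε l && (fun j => zeroVec j ^^ decide (Odd #(univ.filter fun i => α l i && b i j))) j))) =
      (fun j => zeroVec j ^^ decide (Odd #(univ.filter fun i =>
        (fun i => θ₀ i ^^ decide (Odd #(univ.filter fun l => ε l && α l i))) i && b i j))) := by
  classical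
  induction k with
  | zero =>
    funext j
    have e1 : (univ.filter fun l : Fin 0 => ε l && (fun j => zeroVec j ^^ decide (Odd #(univ.filter fun i => α l i && b i j))) j) = ∅ :=
      filter_eq_empty_iff.2 fun l => l.elim0
    have e2 : ∀ i, (univ.filter fun l : Fin 0 => ε l && α l i) = ∅ := fun i => filter_eq_empty_iff.2 fun l => l.elim0
    simp only [e1, e2, card_empty, Nat.not_odd_zero, decide_false, Bool.xor_false]
  | succ k ih =>
    rw [ffr_flatPt_peel (N := n) _ (fun l => (fun j => zeroVec j ^^ decide (Odd #(univ.filter fun i => α l i && b i j)))) ε]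
    have hθ : (fun i => θ₀ i ^^ decide (Odd #(univ.filter fun l => ε l && α l i))) =
        fun i => (θ₀ i ^^ decide (Odd #(univ.filter fun l : Fin k => Fin.tail ε l && Fin.tail α l i))) ^^ (ε 0 && α 0 i) :=
      ffr_flatPt_peel (N := m) θ₀ α ε
    rw [hθ]
    have ih' := ih (Fin.tail α) (Fin.tail ε)
    simp only [Fin.tail] at ih' ⊢
    funext j
    have hj := congrFun ih' j
    beta_reduce at hj
    rw [hj]
    cases ε 0
    · simp only [Bool.false_and, Bool.xor_false]
    · simp only [Bool.true_and]
      exact (congrFun (ffr_flatPt_add b (fun i => θ₀ i ^^ decide (Odd #(univ.filter fun l : Fin k => ε l.succ && α l.succ i))) (α 0)) j).symm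

end Summit.QuantumAdvantage.QuantumAdvantage.Theorems.CubicForrelation.NearExactIsExact

end
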